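import Summits.AnomalousDissipation.AnomalousDissipation.Theorems.MarginalStabilityChainStretchedVortexRowsStubBraidExitTools
import Summits.AnomalousDissipation.AnomalousDissipation.Theorems.MarginalStabilityChainStretchedVortexRowsStubBraidExitDomain

/-!
# Tools for the stub `stub_braidExit` (r4; line `braid-closed-large-circulation-gluing`, crux
# stmt-AnomalousDissipation-3009), part D: Leibniz expansion of the operator, slice differentiability
# of the layers, and the two profiles

The exit-time function of `stub_braidExit` (r4: saddle discs excised) is assembled as
`φ = M · (G(log D) + k · S · W₀(log D) + c₀)` with the radial layer `G(log D)` of part A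
(`G = logProfile Λ s₀`, `Λ = 1 + log(L²/ν)`, `s₀ = log(1 − cos(2πr/L))`), the corrector
`S = sin a sinh b` of part B damped by the weight `W₀(log D) = (10/(10 + D))²` (so that no cutoff is
needed: all corrector terms of `𝒜φ` are bounded on the whole plane, part E), `k = κL/π`. This file
supplies the calculus that turns `𝒜φ` into the closed forms of parts A/B:

* `dX_comb`, `dY_comb`, `dXX_comb`, `dYY_comb`, `rowOperator_comb` — Leibniz rule for the tree's
  slice derivatives `StretchedLayer.dX/dY/lap` on `M(f + k·g·h + c₀)` under pointwise / eventual
  differentiability of the slices (registered def-free form `stub_braidExit_operatorLeibniz`):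
  `νΔφ + uφₓ + vφ_y = M[(νΔf + …) + k(h(νΔg + …) + g(νΔh + …) + 2ν(gₓhₓ + g_yh_y))]`;
* the differentiability inputs for the layers: `eventually_differentiableAt_radialLayer_fst/snd`,
  `differentiableAt_dX/dY_radialLayer` (from part A's closed forms), and the trivial ones for `S`;
* the profiles `logProfile Λ s₀ s = Λ(log(Λ + s − s₀) − log Λ)` (`hasDerivAt_logProfile`:
  `G′ = Λ/(Λ + s − s₀)`, `hasDerivAt_deriv_logProfile`: `G″ = −Λ/(Λ + s − s₀)²`,
  `contDiffOn_logProfile` on `(s₀ − Λ, ∞)`) and `decayProfile s = 100/(10 + eˢ)²`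
  (`hasDerivAt_decayProfile`, `hasDerivAt_deriv_decayProfile`, `contDiff_decayProfile`,
  `decayProfile_mem : 0 ≤ W₀ ≤ 1`).
-/

-- `Summit.<Summit>.<Problem>` is the mandated summit-side namespace (CONVENTIONS §2): duplicate deliberate.
set_option linter.dupNamespace false

noncomputable section

open scoped Topology
open Filter Set

namespace Summit.AnomalousDissipation.AnomalousDissipation.Theorems.MarginalStabilityChainStretchedVortexRows.BraidExit

open Literature.Analysis.FluidPDE Literature.Analysis.FluidPDE.StretchedLayer

/-! ### Slice calculus of the combination `M · (f + k · g · h + c₀)` -/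

section Comb

variable {f g h : ℝ → ℝ → ℝ} {M k c₀ x y : ℝ}

/-- `∂ₓ [M(f + k g h + c₀)] = M(∂ₓf + k(∂ₓg·h + g·∂ₓh))` at a point where the three `x`-slices
are differentiable. [folklore] -/
theorem dX_comb (hf : DifferentiableAt ℝ (fun s => f s y) x)
    (hg : DifferentiableAt ℝ (fun s => g s y) x) (hh : DifferentiableAt ℝ (fun s => h s y) x) :
    dX (fun x y => M * (f x y + k * (g x y * h x y) + c₀)) x y =
      M * (dX f x y + k * (dX g x y * h x y + g x y * dX h x y)) := by
  have hF : HasDerivAt (fun s => M * (f s y + k * (g s y * h s y) + c₀))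
      (M * (dX f x y + k * (dX g x y * h x y + g x y * dX h x y))) x :=
    ((hf.hasDerivAt.add ((hg.hasDerivAt.mul hh.hasDerivAt).const_mul k)).add_const c₀).const_mul M
  exact hF.deriv

/-- `∂_y [M(f + k g h + c₀)] = M(∂_yf + k(∂_yg·h + g·∂_yh))`. [folklore] -/
theorem dY_comb (hf : DifferentiableAt ℝ (fun s => f x s) y)
    (hg : DifferentiableAt ℝ (fun s => g x s) y) (hh : DifferentiableAt ℝ (fun s => h x s) y) :
    dY (fun x y => M * (f x y + k * (g x y * h x y) + c₀)) x y =
      M * (dY f x y + k * (dY g x y * h x y + g x y * dY h x y)) := by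
  have hF : HasDerivAt (fun s => M * (f x s + k * (g x s * h x s) + c₀))
      (M * (dY f x y + k * (dY g x y * h x y + g x y * dY h x y))) y :=
    ((hf.hasDerivAt.add ((hg.hasDerivAt.mul hh.hasDerivAt).const_mul k)).add_const c₀).const_mul M
  exact hF.deriv

/-- `∂ₓ∂ₓ [M(f + k g h + c₀)] = M(∂ₓ²f + k(∂ₓ²g·h + 2∂ₓg ∂ₓh + g ∂ₓ²h))` at a point near which the
`x`-slices are differentiable and at which the `x`-slices of `∂ₓf, ∂ₓg, ∂ₓh` are differentiable
(Leibniz rule for the tree's slice derivatives). [folklore] -/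
theorem dXX_comb (hf : ∀ᶠ s in 𝓝 x, DifferentiableAt ℝ (fun t => f t y) s)
    (hg : ∀ᶠ s in 𝓝 x, DifferentiableAt ℝ (fun t => g t y) s)
    (hh : ∀ᶠ s in 𝓝 x, DifferentiableAt ℝ (fun t => h t y) s)
    (hf2 : DifferentiableAt ℝ (fun s => dX f s y) x) (hg2 : DifferentiableAt ℝ (fun s => dX g s y) x)
    (hh2 : DifferentiableAt ℝ (fun s => dX h s y) x) :
    dX (dX (fun x y => M * (f x y + k * (g x y * h x y) + c₀))) x y =
      M * (dX (dX f) x y +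
        k * (dX (dX g) x y * h x y + 2 * (dX g x y * dX h x y) + g x y * dX (dX h) x y)) := by
  have hev : (fun s => dX (fun x y => M * (f x y + k * (g x y * h x y) + c₀)) s y) =ᶠ[𝓝 x]
      fun s => M * (dX f s y + k * (dX g s y * h s y + g s y * dX h s y)) := by
    filter_upwards [hf, hg, hh] with s hfs hgs hhs
    exact dX_comb hfs hgs hhs
  show deriv (fun s => dX (fun x y => M * (f x y + k * (g x y * h x y) + c₀)) s y) x = _
  rw [hev.deriv_eq]
  have hg1 : HasDerivAt (fun s => g s y) (dX g x y) x := hg.self_of_nhds.hasDerivAt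
  have hh1 : HasDerivAt (fun s => h s y) (dX h x y) x := hh.self_of_nhds.hasDerivAt
  have hF : HasDerivAt (fun s => M * (dX f s y + k * (dX g s y * h s y + g s y * dX h s y)))
      (M * (dX (dX f) x y + k * ((dX (dX g) x y * h x y + dX g x y * dX h x y) +
        (dX g x y * dX h x y + g x y * dX (dX h) x y)))) x :=
    (hf2.hasDerivAt.add (((hg2.hasDerivAt.mul hh1).add (hg1.mul hh2.hasDerivAt)).const_mul k)).const_mul M
  rw [hF.deriv]; ring

/-- `∂_y∂_y [M(f + k g h + c₀)]`, Leibniz rule as for `dXX_comb`. [folklore] -/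
theorem dYY_comb (hf : ∀ᶠ s in 𝓝 y, DifferentiableAt ℝ (fun t => f x t) s)
    (hg : ∀ᶠ s in 𝓝 y, DifferentiableAt ℝ (fun t => g x t) s)
    (hh : ∀ᶠ s in 𝓝 y, DifferentiableAt ℝ (fun t => h x t) s)
    (hf2 : DifferentiableAt ℝ (fun s => dY f x s) y) (hg2 : DifferentiableAt ℝ (fun s => dY g x s) y)
    (hh2 : DifferentiableAt ℝ (fun s => dY h x s) y) :
    dY (dY (fun x y => M * (f x y + k * (g x y * h x y) + c₀))) x y =
      M * (dY (dY f) x y +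
        k * (dY (dY g) x y * h x y + 2 * (dY g x y * dY h x y) + g x y * dY (dY h) x y)) := by
  have hev : (fun s => dY (fun x y => M * (f x y + k * (g x y * h x y) + c₀)) x s) =ᶠ[𝓝 y]
      fun s => M * (dY f x s + k * (dY g x s * h x s + g x s * dY h x s)) := by
    filter_upwards [hf, hg, hh] with s hfs hgs hhs
    exact dY_comb hfs hgs hhs
  show deriv (fun s => dY (fun x y => M * (f x y + k * (g x y * h x y) + c₀)) x s) y = _
  rw [hev.deriv_eq]
  have hg1 : HasDerivAt (fun s => g x s) (dY g x y) y := hg.self_of_nhds.hasDerivAt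
  have hh1 : HasDerivAt (fun s => h x s) (dY h x y) y := hh.self_of_nhds.hasDerivAt
  have hF : HasDerivAt (fun s => M * (dY f x s + k * (dY g x s * h x s + g x s * dY h x s)))
      (M * (dY (dY f) x y + k * ((dY (dY g) x y * h x y + dY g x y * dY h x y) +
        (dY g x y * dY h x y + g x y * dY (dY h) x y)))) y :=
    (hf2.hasDerivAt.add (((hg2.hasDerivAt.mul hh1).add (hg1.mul hh2.hasDerivAt)).const_mul k)).const_mul M
  rw [hF.deriv]; ring

/-- **Leibniz expansion of a drift–diffusion operator on `M(f + k g h + c₀)`**: for any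
coefficients `ν, u, v`, at a point with the differentiability of `dXX_comb`/`dYY_comb`,
`νΔφ + u∂ₓφ + v∂_yφ = M[(νΔf + u fₓ + v f_y) + k(h·(νΔg + …) + g·(νΔh + …) + 2ν(gₓhₓ + g_yh_y))]`.
[folklore] -/
theorem rowOperator_comb (hfx : ∀ᶠ s in 𝓝 x, DifferentiableAt ℝ (fun t => f t y) s)
    (hgx : ∀ᶠ s in 𝓝 x, DifferentiableAt ℝ (fun t => g t y) s)
    (hhx : ∀ᶠ s in 𝓝 x, DifferentiableAt ℝ (fun t => h t y) s)
    (hfx2 : DifferentiableAt ℝ (fun s => dX f s y) x) (hgx2 : DifferentiableAt ℝ (fun s => dX g s y) x)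
    (hhx2 : DifferentiableAt ℝ (fun s => dX h s y) x)
    (hfy : ∀ᶠ s in 𝓝 y, DifferentiableAt ℝ (fun t => f x t) s)
    (hgy : ∀ᶠ s in 𝓝 y, DifferentiableAt ℝ (fun t => g x t) s)
    (hhy : ∀ᶠ s in 𝓝 y, DifferentiableAt ℝ (fun t => h x t) s)
    (hfy2 : DifferentiableAt ℝ (fun s => dY f x s) y) (hgy2 : DifferentiableAt ℝ (fun s => dY g x s) y)
    (hhy2 : DifferentiableAt ℝ (fun s => dY h x s) y) (ν u v : ℝ) :
    ν * lap (fun x y => M * (f x y + k * (g x y * h x y) + c₀)) x y +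
        u * dX (fun x y => M * (f x y + k * (g x y * h x y) + c₀)) x y +
        v * dY (fun x y => M * (f x y + k * (g x y * h x y) + c₀)) x y =
      M * ((ν * lap f x y + u * dX f x y + v * dY f x y) +
        k * (h x y * (ν * lap g x y + u * dX g x y + v * dY g x y) +
          g x y * (ν * lap h x y + u * dX h x y + v * dY h x y) +
          2 * ν * (dX g x y * dX h x y + dY g x y * dY h x y))) := by
  rw [lap_apply, lap_apply, lap_apply, lap_apply, dXX_comb hfx hgx hhx hfx2 hgx2 hhx2,
    dYY_comb hfy hgy hhy hfy2 hgy2 hhy2, dX_comb hfx.self_of_nhds hgx.self_of_nhds hhx.self_of_nhds,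
    dY_comb hfy.self_of_nhds hgy.self_of_nhds hhy.self_of_nhds]
  ring

end Comb

/-! ### Differentiability of the slices of the layers (inputs of the Leibniz expansion) -/

variable {L : ℝ}

/-- Near a point with `D > 0`, `log D ∈ U` the `x`-slices of the radial layer are differentiable. [folklore] -/
theorem eventually_differentiableAt_radialLayer_fst {U : Set ℝ} (hU : IsOpen U) {G G' : ℝ → ℝ}
    (hG : ∀ s ∈ U, HasDerivAt G (G' s) s) {x y : ℝ} (hD : 0 < rowD L x y)
    (hU' : Real.log (rowD L x y) ∈ U) :
    ∀ᶠ s in 𝓝 x, DifferentiableAt ℝ (fun t => radialLayer L G t y) s := by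
  filter_upwards [eventually_rowD_fst hU hD hU'] with s hs
  exact (hasDerivAt_radialLayer_fst hG hs.1 hs.2).differentiableAt

/-- Near a point with `D > 0`, `log D ∈ U` the `y`-slices of the radial layer are differentiable. [folklore] -/
theorem eventually_differentiableAt_radialLayer_snd {U : Set ℝ} (hU : IsOpen U) {G G' : ℝ → ℝ}
    (hG : ∀ s ∈ U, HasDerivAt G (G' s) s) {x y : ℝ} (hD : 0 < rowD L x y)
    (hU' : Real.log (rowD L x y) ∈ U) :
    ∀ᶠ s in 𝓝 y, DifferentiableAt ℝ (fun t => radialLayer L G x t) s := by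
  filter_upwards [eventually_rowD_snd hU hD hU'] with s hs
  exact (hasDerivAt_radialLayer_snd hG hs.1 hs.2).differentiableAt

/-- The `x`-slice of `∂ₓ` of the radial layer is differentiable (at a point with `D > 0`,
`log D ∈ U`, `G` twice differentiable on `U`). [folklore] -/
theorem differentiableAt_dX_radialLayer {U : Set ℝ} (hU : IsOpen U) {G G' G'' : ℝ → ℝ}
    (hG : ∀ s ∈ U, HasDerivAt G (G' s) s) (hG' : ∀ s ∈ U, HasDerivAt G' (G'' s) s)
    {x y : ℝ} (hD : 0 < rowD L x y) (hU' : Real.log (rowD L x y) ∈ U) :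
    DifferentiableAt ℝ (fun s => dX (radialLayer L G) s y) x := by
  have hev : (fun s => G' (Real.log (rowD L s y)) *
      (2 * Real.pi / L * Real.sin (2 * Real.pi * s / L) / rowD L s y)) =ᶠ[𝓝 x]
      fun s => dX (radialLayer L G) s y := by
    filter_upwards [eventually_rowD_fst hU hD hU'] with s hs
    exact (dX_radialLayer hG hs.1 hs.2).symm
  refine DifferentiableAt.congr_of_eventuallyEq ?_ hev.symm
  have hℓ : HasDerivAt (fun s => Real.log (rowD L s y))
      (2 * Real.pi / L * Real.sin (2 * Real.pi * x / L) / rowD L x y) x :=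
    (hasDerivAt_rowD_fst L x y).log hD.ne'
  have h1 : DifferentiableAt ℝ (fun s => G' (Real.log (rowD L s y))) x :=
    ((hG' _ hU').comp x hℓ).differentiableAt
  have hlin : HasDerivAt (fun s : ℝ => 2 * Real.pi * s / L) (2 * Real.pi / L) x := by
    simpa using ((hasDerivAt_id x).const_mul (2 * Real.pi)).div_const L
  have h2 : HasDerivAt (fun s => 2 * Real.pi / L * Real.sin (2 * Real.pi * s / L))
      (2 * Real.pi / L * (Real.cos (2 * Real.pi * x / L) * (2 * Real.pi / L))) x :=
    hlin.sin.const_mul _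
  have h3 : HasDerivAt
      (fun s => 2 * Real.pi / L * Real.sin (2 * Real.pi * s / L) / rowD L s y) _ x :=
    h2.div (hasDerivAt_rowD_fst L x y) hD.ne'
  exact h1.mul h3.differentiableAt

/-- The `y`-slice of `∂_y` of the radial layer is differentiable. [folklore] -/
theorem differentiableAt_dY_radialLayer {U : Set ℝ} (hU : IsOpen U) {G G' G'' : ℝ → ℝ}
    (hG : ∀ s ∈ U, HasDerivAt G (G' s) s) (hG' : ∀ s ∈ U, HasDerivAt G' (G'' s) s)
    {x y : ℝ} (hD : 0 < rowD L x y) (hU' : Real.log (rowD L x y) ∈ U) :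
    DifferentiableAt ℝ (fun s => dY (radialLayer L G) x s) y := by
  have hev : (fun s => G' (Real.log (rowD L x s)) *
      (2 * Real.pi / L * Real.sinh (2 * Real.pi * s / L) / rowD L x s)) =ᶠ[𝓝 y]
      fun s => dY (radialLayer L G) x s := by
    filter_upwards [eventually_rowD_snd hU hD hU'] with s hs
    exact (dY_radialLayer hG hs.1 hs.2).symm
  refine DifferentiableAt.congr_of_eventuallyEq ?_ hev.symm
  have hℓ : HasDerivAt (fun s => Real.log (rowD L x s))
      (2 * Real.pi / L * Real.sinh (2 * Real.pi * y / L) / rowD L x y) y :=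
    (hasDerivAt_rowD_snd L x y).log hD.ne'
  have h1 : DifferentiableAt ℝ (fun s => G' (Real.log (rowD L x s))) y :=
    ((hG' _ hU').comp y hℓ).differentiableAt
  have hlin : HasDerivAt (fun s : ℝ => 2 * Real.pi * s / L) (2 * Real.pi / L) y := by
    simpa using ((hasDerivAt_id y).const_mul (2 * Real.pi)).div_const L
  have h2 : HasDerivAt (fun s => 2 * Real.pi / L * Real.sinh (2 * Real.pi * s / L))
      (2 * Real.pi / L * (Real.cosh (2 * Real.pi * y / L) * (2 * Real.pi / L))) y :=
    hlin.sinh.const_mul _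
  have h3 : HasDerivAt
      (fun s => 2 * Real.pi / L * Real.sinh (2 * Real.pi * s / L) / rowD L x s) _ y :=
    h2.div (hasDerivAt_rowD_snd L x y) hD.ne'
  exact h1.mul h3.differentiableAt

/-- The slices of the corrector `S` are differentiable (everywhere). [folklore] -/
theorem eventually_differentiableAt_rowS_fst (L x y : ℝ) :
    ∀ᶠ s in 𝓝 x, DifferentiableAt ℝ (fun t => rowS L t y) s :=
  Filter.Eventually.of_forall fun s => (hasDerivAt_rowS_fst L s y).differentiableAt

/-- The slices of the corrector `S` are differentiable (everywhere). [folklore] -/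
theorem eventually_differentiableAt_rowS_snd (L x y : ℝ) :
    ∀ᶠ s in 𝓝 y, DifferentiableAt ℝ (fun t => rowS L x t) s :=
  Filter.Eventually.of_forall fun s => (hasDerivAt_rowS_snd L x s).differentiableAt

/-- `∂ₓS` has differentiable `x`-slices. [folklore] -/
theorem differentiableAt_dX_rowS (L x y : ℝ) : DifferentiableAt ℝ (fun s => dX (rowS L) s y) x := by
  rw [dX_rowS]; fun_prop

/-- `∂_yS` has differentiable `y`-slices. [folklore] -/
theorem differentiableAt_dY_rowS (L x y : ℝ) : DifferentiableAt ℝ (fun s => dY (rowS L) x s) y := by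
  rw [dY_rowS]; fun_prop

/-! ### The two profiles: `G(s) = Λ log((Λ + s − s₀)/Λ)` and `W₀(s) = 100/(10 + eˢ)²` -/

/-- The concave radial profile `G(s) = Λ (log(Λ + s − s₀) − log Λ)` (`= Λ log(1 + (s − s₀)/Λ)`):
`G(s₀) = 0`, `G′ = Λ/(Λ + s − s₀) ∈ (0, 1]` on `s ≥ s₀`, `G″ < 0`. [folklore] -/
def logProfile (Λ s₀ s : ℝ) : ℝ := Λ * (Real.log (Λ + s - s₀) - Real.log Λ)

/-- `G′(s) = Λ/(Λ + s − s₀)` on `U = (s₀ − Λ, ∞)`. [folklore] -/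
theorem hasDerivAt_logProfile (Λ s₀ : ℝ) {s : ℝ} (hs : s ∈ Ioi (s₀ - Λ)) :
    HasDerivAt (logProfile Λ s₀) (Λ / (Λ + s - s₀)) s := by
  have hpos : 0 < Λ + s - s₀ := by simp only [mem_Ioi] at hs; linarith
  have h1 : HasDerivAt (fun t : ℝ => Λ + t - s₀) 1 s := by
    simpa using ((hasDerivAt_id s).const_add Λ).sub_const s₀
  have h2 := (h1.log hpos.ne').sub_const (Real.log Λ) |>.const_mul Λ
  unfold logProfile
  exact h2.congr_deriv (by field_simp)

/-- `G″(s) = −Λ/(Λ + s − s₀)²` on `U`. [folklore] -/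
theorem hasDerivAt_deriv_logProfile (Λ s₀ : ℝ) {s : ℝ} (hs : s ∈ Ioi (s₀ - Λ)) :
    HasDerivAt (fun t => Λ / (Λ + t - s₀)) (-Λ / (Λ + s - s₀) ^ 2) s := by
  have hpos : 0 < Λ + s - s₀ := by simp only [mem_Ioi] at hs; linarith
  have h1 : HasDerivAt (fun t : ℝ => Λ + t - s₀) 1 s := by
    simpa using ((hasDerivAt_id s).const_add Λ).sub_const s₀
  have h2 := (hasDerivAt_const s Λ).div h1 hpos.ne'
  exact h2.congr_deriv (by field_simp; ring)

/-- `G` is smooth on `U = (s₀ − Λ, ∞)`. [folklore] -/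
theorem contDiffOn_logProfile (Λ s₀ : ℝ) {n : WithTop ℕ∞} :
    ContDiffOn ℝ n (logProfile Λ s₀) (Ioi (s₀ - Λ)) := by
  unfold logProfile
  have h : ContDiffOn ℝ n (fun t : ℝ => Λ + t - s₀) (Ioi (s₀ - Λ)) := by fun_prop
  have hlog : ContDiffOn ℝ n (fun t : ℝ => Real.log (Λ + t - s₀)) (Ioi (s₀ - Λ)) :=
    h.log fun t ht => by simp only [mem_Ioi] at ht; linarith
  exact contDiffOn_const.mul (hlog.sub contDiffOn_const)

/-- The decaying corrector weight in the `log D` variable: `W₀(s) = 100/(10 + eˢ)²`, i.e. the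
weight `w(D) = (10/(10 + D))²` on the corrector `S`. [folklore] -/
def decayProfile (s : ℝ) : ℝ := 100 / (10 + Real.exp s) ^ 2

/-- `W₀′(s) = −200 eˢ/(10 + eˢ)³`. [folklore] -/
theorem hasDerivAt_decayProfile (s : ℝ) :
    HasDerivAt decayProfile (-200 * Real.exp s / (10 + Real.exp s) ^ 3) s := by
  have hpos : 0 < 10 + Real.exp s := by positivity
  have h1 : HasDerivAt (fun t => (10 + Real.exp t) ^ 2)
      (((2 : ℕ) : ℝ) * (10 + Real.exp s) ^ (2 - 1) * Real.exp s) s :=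
    ((Real.hasDerivAt_exp s).const_add 10).pow 2
  have h2 : HasDerivAt (fun t => (100 : ℝ) / (10 + Real.exp t) ^ 2) _ s :=
    (hasDerivAt_const s (100 : ℝ)).div h1 (by positivity)
  unfold decayProfile
  exact h2.congr_deriv (by push_cast; field_simp; ring)

/-- `W₀″(s) = −200 eˢ (10 − 2eˢ)/(10 + eˢ)⁴`. [folklore] -/
theorem hasDerivAt_deriv_decayProfile (s : ℝ) :
    HasDerivAt (fun t => -200 * Real.exp t / (10 + Real.exp t) ^ 3)
      (-200 * Real.exp s * (10 - 2 * Real.exp s) / (10 + Real.exp s) ^ 4) s := by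
  have hpos : 0 < 10 + Real.exp s := by positivity
  have h1 : HasDerivAt (fun t => (10 + Real.exp t) ^ 3)
      (((3 : ℕ) : ℝ) * (10 + Real.exp s) ^ (3 - 1) * Real.exp s) s :=
    ((Real.hasDerivAt_exp s).const_add 10).pow 3
  have h2 : HasDerivAt (fun t => -200 * Real.exp t / (10 + Real.exp t) ^ 3) _ s :=
    ((Real.hasDerivAt_exp s).const_mul (-200)).div h1 (by positivity)
  exact h2.congr_deriv (by push_cast; field_simp; ring)

/-- `W₀` is smooth. [folklore] -/
theorem contDiff_decayProfile {n : WithTop ℕ∞} : ContDiff ℝ n decayProfile := by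
  unfold decayProfile
  refine ContDiff.div contDiff_const (by fun_prop) fun s => ?_
  positivity

/-- `0 ≤ W₀ ≤ 1`. [folklore] -/
theorem decayProfile_mem (s : ℝ) : 0 ≤ decayProfile s ∧ decayProfile s ≤ 1 := by
  unfold decayProfile
  have h := Real.exp_pos s
  refine ⟨by positivity, ?_⟩
  rw [div_le_one (by positivity)]
  nlinarith

/-- **Registered sub-goal `stub_braidExit_operatorLeibniz`** (def-free form of `rowOperator_comb`):
Leibniz expansion of a drift–diffusion operator with arbitrary coefficients `ν, u, v` on the
combination `M(f + k g h + c₀)` in the tree's slice derivatives. [folklore] -/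
theorem stub_braidExit_operatorLeibniz : ∀ (f g h : ℝ → ℝ → ℝ) (M k c₀ x y ν u v : ℝ), (∀ᶠ s in 𝓝 x, DifferentiableAt ℝ (fun t => f t y) s) → (∀ᶠ s in 𝓝 x, DifferentiableAt ℝ (fun t => g t y) s) → (∀ᶠ s in 𝓝 x, DifferentiableAt ℝ (fun t => h t y) s) → DifferentiableAt ℝ (fun s => dX f s y) x → DifferentiableAt ℝ (fun s => dX g s y) x → DifferentiableAt ℝ (fun s => dX h s y) x → (∀ᶠ s in 𝓝 y, DifferentiableAt ℝ (fun t => f x t) s) → (∀ᶠ s in 𝓝 y, DifferentiableAt ℝ (fun t => g x t) s) → (∀ᶠ s in 𝓝 y, DifferentiableAt ℝ (fun t => h x t) s) → DifferentiableAt ℝ (fun s => dY f x s) y → DifferentiableAt ℝ (fun s => dY g x s) y → DifferentiableAt ℝ (fun s => dY h x s) y → ν * lap (fun x y => M * (f x y + k * (g x y * h x y) + c₀)) x y + u * dX (fun x y => M * (f x y + k * (g x y * h x y) + c₀)) x y + v * dY (fun x y => M * (f x y + k * (g x y * h x y) + c₀)) x y = M * ((ν * lap f x y + u * dX f x y + v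 * dY f x y) + k * (h x y * (ν * lap g x y + u * dX g x y + v * dY g x y) + g x y * (ν * lap h x y + u * dX h x y + v * dY h x y) + 2 * ν * (dX g x y * dX h x y + dY g x y * dY h x y))) := by
  intro f g h M k c₀ x y ν u v hfx hgx hhx hfx2 hgx2 hhx2 hfy hgy hhy hfy2 hgy2 hhy2
  exact rowOperator_comb hfx hgx hhx hfx2 hgx2 hhx2 hfy hgy hhy hfy2 hgy2 hhy2 ν u v

end Summit.AnomalousDissipation.AnomalousDissipation.Theorems.MarginalStabilityChainStretchedVortexRows.BraidExit

end
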